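import Mathlib
import Summits.Ventures.PercRepro.TriangleCapRegularCellGap

/-!
# PercRepro — THE SECOND GAP OF THE REGULAR CELL, FOR EVERY `ℓ ≥ 4`: NOTHING BETWEEN `bottom + ℓ − 1` AND
`bottom + 2ℓ − 4` (p3, gen 54; part 291)

In the regular cell `t = ℓ D` the row excess `E = Σ_{rows} k (ℓ − k)` (twice `j − bottomReg`) is `0` or `2 (ℓ − 1)`
or at least `4 (ℓ − 2)`: with `P` partial rows, `P = 1` is impossible (part 290); `P = 2` forces the two sizes to
sum to `ℓ` (their sum is `≡ 0 (mod ℓ)` and lies in `[2, 2ℓ − 2]`), so `E = 2 k (ℓ − k)`, which is `2 (ℓ − 1)` at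
`k ∈ {1, ℓ − 1}` and at least `4 (ℓ − 2)` otherwise; `P = 3` forces the three sizes to sum to `ℓ` or `2ℓ`, and
`Σ k_i² ≤ (ℓ − 2)² + 2` (resp. `2 (ℓ − 1)² + 4`) gives `E ≥ 4ℓ − 6`; `P ≥ 4` gives `E ≥ 4 (ℓ − 1)`.  The pair of
rows `(2, ℓ − 2)` attains `E = 4 (ℓ − 2)`.  THEOREM (`regular_cell_second_gap`, `4 ≤ ℓ ≤ D`): every band value `j`
of the regular cell is `bottomReg`, or `bottomReg + ℓ − 1`, or at least `bottomReg + 2ℓ − 4`, and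
`bottomReg + 2ℓ − 4` is attained — **THE SECOND GAP IS EXACTLY `[bottomReg + ℓ, bottomReg + 2ℓ − 5]`**
(empty at `ℓ = 4`, `{bottom + 5}` at `ℓ = 5`, `{bottom + 6, bottom + 7}` at `ℓ = 6`, … — the census of §10dm).
Axioms: standard.
-/

namespace PercRepro

namespace TriangleCap

namespace C047

open Finset

/-- Two sizes in `[1, ℓ − 1]` summing to a multiple of `ℓ` sum to `ℓ`. -/
theorem two_sizes_sum (ℓ a b c : ℕ) (ha1 : 1 ≤ a) (ha2 : a < ℓ) (hb1 : 1 ≤ b) (hb2 : b < ℓ)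
    (h : a + b = ℓ * c) : a + b = ℓ := by
  have hc1 : 0 < ℓ * c := by omega
  have hc2 : ℓ * c < ℓ * 2 := by omega
  have hc : c < 2 := Nat.lt_of_mul_lt_mul_left hc2
  have hc0 : 0 < c := by
    rcases Nat.eq_zero_or_pos c with rfl | h
    · omega
    · exact h
  have : c = 1 := by omega
  subst this
  omega

/-- Three sizes in `[1, ℓ − 1]` summing to a multiple of `ℓ` sum to `ℓ` or `2 ℓ`. -/
theorem three_sizes_sum (ℓ a b d c : ℕ) (ha1 : 1 ≤ a) (ha2 : a < ℓ) (hb1 : 1 ≤ b) (hb2 : b < ℓ) (hd1 : 1 ≤ d)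
    (hd2 : d < ℓ) (h : a + b + d = ℓ * c) : a + b + d = ℓ ∨ a + b + d = 2 * ℓ := by
  have hc1 : 0 < ℓ * c := by omega
  have hc2 : ℓ * c < ℓ * 3 := by omega
  have hc : c < 3 := Nat.lt_of_mul_lt_mul_left hc2
  have hc0 : 0 < c := by
    rcases Nat.eq_zero_or_pos c with rfl | h
    · omega
    · exact h
  rcases (show c = 1 ∨ c = 2 by omega) with rfl | rfl
  · left
    omega
  · right
    omega

/-- The excess of two partial rows: `a (ℓ − a) + b (ℓ − b)` with `a + b = ℓ` is `2 (ℓ − 1)` at `a ∈ {1, ℓ − 1}` and at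
least `4 (ℓ − 2)` otherwise. -/
theorem excess_two (ℓ a b : ℕ) (ha1 : 1 ≤ a) (hb1 : 1 ≤ b) (h : a + b = ℓ) :
    a * (ℓ - a) + b * (ℓ - b) = 2 * (ℓ - 1) ∨ 4 * (ℓ - 2) ≤ a * (ℓ - a) + b * (ℓ - b) := by
  have e1 : ℓ - a = b := by omega
  have e2 : ℓ - b = a := by omega
  rw [e1, e2]
  rcases (show a = 1 ∨ b = 1 ∨ (2 ≤ a ∧ 2 ≤ b) by omega) with rfl | rfl | ⟨ha2, hb2⟩
  · left
    omega
  · left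
    omega
  · right
    obtain ⟨a', rfl⟩ : ∃ a', a = a' + 2 := ⟨a - 2, by omega⟩
    obtain ⟨b', rfl⟩ : ∃ b', b = b' + 2 := ⟨b - 2, by omega⟩
    subst h
    have : a' + 2 + (b' + 2) - 2 = a' + b' + 2 := by omega
    rw [this]
    nlinarith

/-- The excess of three partial rows summing to `ℓ`: at least `4 ℓ − 6`. -/
theorem excess_three_low (ℓ a b d : ℕ) (ha1 : 1 ≤ a) (hb1 : 1 ≤ b) (hd1 : 1 ≤ d) (h : a + b + d = ℓ) :
    4 * ℓ - 6 ≤ a * (ℓ - a) + b * (ℓ - b) + d * (ℓ - d) := by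
  obtain ⟨a', rfl⟩ : ∃ a', a = a' + 1 := ⟨a - 1, by omega⟩
  obtain ⟨b', rfl⟩ : ∃ b', b = b' + 1 := ⟨b - 1, by omega⟩
  obtain ⟨d', rfl⟩ : ∃ d', d = d' + 1 := ⟨d - 1, by omega⟩
  subst h
  have e1 : a' + 1 + (b' + 1) + (d' + 1) - (a' + 1) = b' + d' + 2 := by omega
  have e2 : a' + 1 + (b' + 1) + (d' + 1) - (b' + 1) = a' + d' + 2 := by omega
  have e3 : a' + 1 + (b' + 1) + (d' + 1) - (d' + 1) = a' + b' + 2 := by omega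
  have e4 : 4 * (a' + 1 + (b' + 1) + (d' + 1)) - 6 = 4 * (a' + b' + d') + 6 := by omega
  rw [e1, e2, e3, e4]
  nlinarith [Nat.zero_le (a' * b'), Nat.zero_le (a' * d'), Nat.zero_le (b' * d')]

/-- The excess of three partial rows summing to `2 ℓ` (each `≤ ℓ − 1`): at least `4 ℓ − 6`. -/
theorem excess_three_high (ℓ a b d : ℕ) (ha2 : a < ℓ) (hb2 : b < ℓ) (hd2 : d < ℓ) (h : a + b + d = 2 * ℓ) :
    4 * ℓ - 6 ≤ a * (ℓ - a) + b * (ℓ - b) + d * (ℓ - d) := by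
  -- the complements `ℓ − a, ℓ − b, ℓ − d` are three sizes summing to `ℓ`
  have := excess_three_low ℓ (ℓ - a) (ℓ - b) (ℓ - d) (by omega) (by omega) (by omega) (by omega)
  have e1 : ℓ - (ℓ - a) = a := by omega
  have e2 : ℓ - (ℓ - b) = b := by omega
  have e3 : ℓ - (ℓ - d) = d := by omega
  rw [e1, e2, e3] at this
  rw [mul_comm a, mul_comm b, mul_comm d]
  exact this

/-- **THE ROW EXCESS IS `0`, `2 (ℓ − 1)` OR AT LEAST `4 (ℓ − 2)`** (`4 ≤ ℓ`): with `Σ_{m < N} k m = ℓ D`,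
`1 ≤ k m ≤ ℓ`. -/
theorem row_excess_trichotomy (ℓ D : ℕ) (k : ℕ → ℕ) (N : ℕ) (hℓ : 4 ≤ ℓ) (hk : ∀ m, m < N → 1 ≤ k m)
    (hkℓ : ∀ m, m < N → k m ≤ ℓ) (hsum : ∑ m ∈ range N, k m = ℓ * D) :
    ∑ m ∈ range N, k m * (ℓ - k m) = 0 ∨ ∑ m ∈ range N, k m * (ℓ - k m) = 2 * (ℓ - 1) ∨
      4 * (ℓ - 2) ≤ ∑ m ∈ range N, k m * (ℓ - k m) := by
  have hne := partial_count_ne_one ℓ D k N (by omega) hk hkℓ hsum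
  unfold partialCount at hne
  have hsplit := sum_eq_mul_full_add_partial ℓ k N hkℓ
  set P := (range N).filter (fun m => k m < ℓ) with hP
  set F := ((range N).filter (fun m => ¬ k m < ℓ)).card with hF
  have hex : ∑ m ∈ range N, k m * (ℓ - k m) = ∑ m ∈ P, k m * (ℓ - k m) := by
    rw [hP, sum_filter]
    apply sum_congr rfl
    intro m hm
    have := hkℓ m (mem_range.mp hm)
    split_ifs with h
    · rfl
    · have : k m = ℓ := by omega
      rw [this, Nat.sub_self, mul_zero]
  have hmemP : ∀ m ∈ P, 1 ≤ k m ∧ k m < ℓ := fun m hm => by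
    rw [hP, mem_filter, mem_range] at hm
    exact ⟨hk m hm.1, hm.2⟩
  have hFD : F ≤ D := by
    have h1 : ℓ * F ≤ ℓ * D := by omega
    exact Nat.le_of_mul_le_mul_left h1 (by omega)
  have hsumP : ∑ m ∈ P, k m = ℓ * (D - F) := by
    rw [Nat.mul_sub]
    omega
  rw [hex]
  rcases Nat.lt_or_ge P.card 4 with hlt | hge
  · interval_cases hc : P.card
    · left
      rw [card_eq_zero.mp hc, sum_empty]
    · exact absurd rfl hne
    · -- two partial rows
      obtain ⟨x, y, hxy, hPxy⟩ := card_eq_two.mp hc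
      have hx := hmemP x (by rw [hPxy]; simp)
      have hy := hmemP y (by rw [hPxy]; simp)
      rw [hPxy, sum_pair hxy] at hsumP ⊢
      have h2 := two_sizes_sum ℓ (k x) (k y) (D - F) hx.1 hx.2 hy.1 hy.2 hsumP
      rcases excess_two ℓ (k x) (k y) hx.1 hy.1 h2 with h | h
      · right
        left
        exact h
      · right
        right
        exact h
    · -- three partial rows
      obtain ⟨x, y, z, hxy, hxz, hyz, hPxyz⟩ := card_eq_three.mp hc
      have hx := hmemP x (by rw [hPxyz]; simp)
      have hy := hmemP y (by rw [hPxyz]; simp)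
      have hz := hmemP z (by rw [hPxyz]; simp)
      have hsum3 : ∑ m ∈ ({x, y, z} : Finset ℕ), k m = k x + k y + k z := by
        rw [sum_insert (by simp [hxy, hxz]), sum_insert (by simp [hyz]), sum_singleton]
        ring
      have hsum3' : ∑ m ∈ ({x, y, z} : Finset ℕ), k m * (ℓ - k m) =
          k x * (ℓ - k x) + k y * (ℓ - k y) + k z * (ℓ - k z) := by
        rw [sum_insert (by simp [hxy, hxz]), sum_insert (by simp [hyz]), sum_singleton]
        ring
      rw [hPxyz, hsum3] at hsumP
      rw [hPxyz, hsum3']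
      right
      right
      rcases three_sizes_sum ℓ (k x) (k y) (k z) (D - F) hx.1 hx.2 hy.1 hy.2 hz.1 hz.2 hsumP with h | h
      · have := excess_three_low ℓ (k x) (k y) (k z) hx.1 hy.1 hz.1 h
        omega
      · have := excess_three_high ℓ (k x) (k y) (k z) hx.2 hy.2 hz.2 h
        omega
  · -- at least four partial rows, each at least `ℓ − 1`
    right
    right
    calc 4 * (ℓ - 2) ≤ 4 * (ℓ - 1) := Nat.mul_le_mul_left 4 (by omega)
      _ ≤ P.card * (ℓ - 1) := Nat.mul_le_mul_right _ hge
      _ = ∑ _m ∈ P, (ℓ - 1) := by rw [sum_const, smul_eq_mul]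
      _ ≤ ∑ m ∈ P, k m * (ℓ - k m) := by
        apply sum_le_sum
        intro m hm
        exact pred_le_mul_sub (k m) ℓ (hmemP m hm).1 (hmemP m hm).2

/-- The rows `(2, ℓ − 2, ℓ, …, ℓ)`: `D + 1` rows summing to `ℓ D` with excess `4 (ℓ − 2)`. -/
def rowsGapTwo (ℓ m : ℕ) : ℕ := if m = 0 then 2 else if m = 1 then ℓ - 2 else ℓ

/-- The row sum of `rowsGapTwo`: `ℓ D` (`4 ≤ ℓ`, `1 ≤ D`). -/
theorem sum_rowsGapTwo (ℓ D : ℕ) (hℓ : 4 ≤ ℓ) (hD : 1 ≤ D) : ∑ m ∈ range (D + 1), rowsGapTwo ℓ m = ℓ * D := by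
  obtain ⟨D', rfl⟩ : ∃ D', D = D' + 1 := ⟨D - 1, by omega⟩
  rw [sum_range_succ', sum_range_succ']
  have h : ∀ m ∈ range D', rowsGapTwo ℓ (m + 1 + 1) = ℓ := fun m _ => by
    unfold rowsGapTwo
    rw [if_neg (by omega), if_neg (by omega)]
  rw [sum_congr rfl h, sum_const, card_range, smul_eq_mul]
  unfold rowsGapTwo
  simp only [if_true, if_false, zero_add, one_ne_zero]
  have : D' * ℓ + (ℓ - 2) + 2 = ℓ * (D' + 1) := by
    obtain ⟨ℓ', rfl⟩ : ∃ ℓ', ℓ = ℓ' + 2 := ⟨ℓ - 2, by omega⟩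
    rw [Nat.add_sub_cancel]
    ring
  omega

/-- The excess of `rowsGapTwo`: `4 (ℓ − 2)`. -/
theorem excess_rowsGapTwo (ℓ D : ℕ) (hℓ : 4 ≤ ℓ) (hD : 1 ≤ D) :
    ∑ m ∈ range (D + 1), rowsGapTwo ℓ m * (ℓ - rowsGapTwo ℓ m) = 4 * (ℓ - 2) := by
  obtain ⟨D', rfl⟩ : ∃ D', D = D' + 1 := ⟨D - 1, by omega⟩
  rw [sum_range_succ', sum_range_succ']
  have h : ∀ m ∈ range D', rowsGapTwo ℓ (m + 1 + 1) * (ℓ - rowsGapTwo ℓ (m + 1 + 1)) = 0 := fun m _ => by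
    unfold rowsGapTwo
    rw [if_neg (by omega), if_neg (by omega), Nat.sub_self, mul_zero]
  rw [sum_congr rfl h, sum_const_zero]
  unfold rowsGapTwo
  simp only [if_true, if_false, zero_add, one_ne_zero]
  have : ℓ - (ℓ - 2) = 2 := by omega
  rw [this]
  omega

/-- **THE SECOND GAP OF THE REGULAR CELL:** for `4 ≤ ℓ ≤ D`, `t = ℓ D`, `2 t ≤ s`: every band value `j` of a
triangle-free graph on `ℓ + 1 + (s − t)` vertices with `s` edges, a vertex of degree `s − t` and every off-degree
`≤ D` is `bottomReg ℓ D`, or `bottomReg ℓ D + (ℓ − 1)`, or at least `bottomReg ℓ D + 2 (ℓ − 2)`, and the value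
`bottomReg ℓ D + 2 (ℓ − 2)` is attained. -/
theorem regular_cell_second_gap (s t ℓ D : ℕ) (hℓ : 4 ≤ ℓ) (hℓD : ℓ ≤ D) (ht : t = ℓ * D) (hs : 2 * t ≤ s) :
    (∀ j, (∃ (H : SimpleGraph (Fin (ℓ + 1 + (s - t)))) (_ : DecidableRel H.Adj), H.CliqueFree 3 ∧
        H.edgeFinset.card = s ∧ ∃ w, deg H w + t = s ∧ (∀ v, offDeg H w v ≤ D) ∧
          ∑ v, deg H v * deg H v + 2 * (t * (s - t - 1)) + 2 * j = s * (s + 1)) →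
      j = bottomReg ℓ D ∨ j = bottomReg ℓ D + (ℓ - 1) ∨ bottomReg ℓ D + 2 * (ℓ - 2) ≤ j) ∧
    (∃ (H : SimpleGraph (Fin (ℓ + 1 + (s - t)))) (_ : DecidableRel H.Adj), H.CliqueFree 3 ∧
        H.edgeFinset.card = s ∧ ∃ w, deg H w + t = s ∧ (∀ v, offDeg H w v ≤ D) ∧
          ∑ v, deg H v * deg H v + 2 * (t * (s - t - 1)) + 2 * (bottomReg ℓ D + 2 * (ℓ - 2)) = s * (s + 1)) := by
  subst ht
  have hb := two_mul_bottomReg ℓ D (by omega) hℓD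
  refine ⟨fun j hj => ?_, ?_⟩
  · obtain ⟨N, k, hk, hsum, hid⟩ := (regular_cell_iff s (ℓ * D) ℓ D j (by omega) hℓD rfl hs).mp hj
    rcases row_excess_trichotomy ℓ D k N hℓ (fun m hm => (hk m hm).1) (fun m hm => (hk m hm).2) hsum
      with h0 | h1 | h2
    · left
      omega
    · right
      left
      omega
    · right
      right
      omega
  · apply (regular_cell_iff s (ℓ * D) ℓ D (bottomReg ℓ D + 2 * (ℓ - 2)) (by omega) hℓD rfl hs).mpr
    refine ⟨D + 1, rowsGapTwo ℓ, fun m _ => ?_, sum_rowsGapTwo ℓ D hℓ (by omega), ?_⟩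
    · unfold rowsGapTwo
      split_ifs <;> omega
    · rw [excess_rowsGapTwo ℓ D hℓ (by omega)]
      omega

end C047

end TriangleCap

end PercRepro
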